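import Summits.CriticalPhenomena.CardyFormulaZ2.Theorems.CardyFlipRussoVoronoiHubFromSmirnovReduction
import Summits.CriticalPhenomena.CardyFormulaZ2.Theorems.CardyFlipRussoVoronoiHubFromSmirnovStubIdentificationCovariance
import Summits.CriticalPhenomena.CardyFormulaZ2.Theorems.CardyFlipRussoVoronoiHubFromSmirnovTransportIntensity
import Summits.CriticalPhenomena.CardyFormulaZ2.Theorems.CardyFlipRussoVoronoiHubFromSmirnovRestrictLocal
import Literature.Analysis.FunctionSpaces.PoissonPointProcessProofs
import Literature.Analysis.FunctionSpaces.PoissonMappingRestricted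
import Mathlib.MeasureTheory.Measure.Lebesgue.Complex

/-!
# Stub S3a `stub_transportCoupling` of line `moebius-exact-delaunay-dilation-ward`
# (crux `VoronoiHubFromSmirnov`, stmt-CriticalPhenomena-6433, route `CardyFlipRusso`)

**The transport COUPLING** (`Sig.stub_transportCoupling`, Defs module): for `h` holomorphic and
injective on an open `U ⊇ closure Ω`, a bounded open `V` with `closure Ω ⊆ V`, `closure V ⊆ U`,
and an admissible profile `ρ = ‖h′‖²` on `V`, the HOMOGENEOUS annealed crossing probability of the
image rectangle `h • R` and the probability, under the INHOMOGENEOUS model `ρ`, of the transported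
crossing event `hCrossEvent R h V δ` (the crossing event of `h • R` read on the images
`h(δ b)/δ` of the nuclei `b` with `δ b ∈ V`) differ by `o(1)` as `δ → 0⁺`.

Proof (Benjamini–Schramm 1998 §3, "separation of measure and metric"; Kingman 1993 §§2.2–2.3).
* EVENT (`hCrossEvent_eq_preimage`): `hCrossEvent R h V δ` is, by definition, the preimage of
  `crossEvent (h • R) δ` under transport of both colours by
  `T = PointConfig.imageRestrict (transportMap h δ) (V/δ)` (arcs and closed carrier of `h • R`
  are `h`-images: `arc_imageUnivalent`, `carrier_imageUnivalent`).
* LAW (`map_transport_poissonLaw`): `T_* Poisson(ρ(δ·) Leb) = (restrict (h(V)/δ))_* Poisson(Leb)`: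
  both sides are Poisson with intensity `Leb|_{h(V)/δ}` — the left by the restricted Mapping
  Theorem `IsPoissonPointProcess.map_imageRestrict` (Literature, p154526) and the change of
  variables `map_transport_intensity_eq` (p154245: the real Jacobian of `b ↦ h(δ b)/δ` is
  `‖h′(δ b)‖² = ρ(δ b)`), the right by the Restriction Theorem `restrict_holds`; Rényi uniqueness
  `unique_holds` identifies them.  Hence, `crossEvent (h • R) δ` being measurable (S0,
  `stub_measurableCrossEvent`), `P_ρ(hCrossEvent) = P_1{(c ∩ h(V)/δ) crosses h • R}` for every
  `δ > 0` (`transportCoupling_core`, product measures via `Measure.map_prod_map`).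
* LOCALITY: the right side is `homCrossProb (h • R) δ + o(1)` by `homCrossProb_restrict_tendsto`
  (p154414: the crossing event ignores nuclei outside the open `h(V) ⊇ closure (h Ω)` with high
  probability — no void balls).
* `h` is only known on `U`; it is first replaced by the measurable modification `U.indicator h`,
  which changes neither event (`crossEvent_imageUnivalent_congr`, `hCrossEvent_congr`).

References: I. Benjamini, O. Schramm, Comm. Math. Phys. 197 (1998) 75–107, §3 and Thm 2.1;
J. F. C. Kingman, *Poisson Processes* (1993), §2.2 Restriction Theorem, §2.3 Mapping Theorem;
A. Rényi, uniqueness (1967).  No new definitions.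
-/

noncomputable section

namespace Summit.CriticalPhenomena.CardyFormulaZ2.Cruxes.VoronoiHubFromSmirnov.MoebiusExactDelaunayDilationWard

open scoped Topology ENNReal
open Filter Set MeasureTheory Metric
open Literature.Analysis.FunctionSpaces
open Literature.Probability.RandomPlanarGeometry


/-! ### Elementary facts about the transport map at mesh `δ > 0` -/

section Elementary

variable {h : ℂ → ℂ} {V : Set ℂ} {δ : ℝ}

/-- The transport map is measurable when `h` is. -/
theorem measurable_transportMap (hh : Measurable h) (δ : ℝ) : Measurable (transportMap h δ) := by
  unfold transportMap
  exact (hh.comp (measurable_const.mul measurable_id)).div_const _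

/-- The configuration-coordinate window `V/δ = {b | δ b ∈ V}` is open for open `V`. -/
theorem isOpen_window (hV : IsOpen V) (δ : ℝ) : IsOpen {b : ℂ | (δ : ℂ) * b ∈ V} :=
  hV.preimage (continuous_const.mul continuous_id)

/-- The window `V/δ` lies in a compact ball when `V` is bounded and `δ > 0`. -/
theorem exists_isCompact_window (hVb : Bornology.IsBounded V) (hδ : 0 < δ) :
    ∃ K : Set ℂ, IsCompact K ∧ {b : ℂ | (δ : ℂ) * b ∈ V} ⊆ K := by
  obtain ⟨r, hr⟩ := hVb.subset_closedBall 0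
  refine ⟨closedBall 0 (r / δ), isCompact_closedBall _ _, fun b hb => ?_⟩
  have hb' : ‖(δ : ℂ) * b‖ ≤ r := by simpa using hr hb
  rw [norm_mul, Complex.norm_real, Real.norm_of_nonneg hδ.le] at hb'
  rw [mem_closedBall, dist_zero_right, le_div_iff₀ hδ, mul_comm]
  exact hb'

/-- The transport map is injective on the window when `h` is injective on `V` and `δ ≠ 0`. -/
theorem injOn_transportMap (hi : InjOn h V) (hδ : δ ≠ 0) :
    InjOn (transportMap h δ) {b : ℂ | (δ : ℂ) * b ∈ V} := by
  intro b hb b' hb' hbb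
  have hδ' : (δ : ℂ) ≠ 0 := Complex.ofReal_ne_zero.2 hδ
  unfold transportMap at hbb
  have h1 : h ((δ : ℂ) * b) = h ((δ : ℂ) * b') := by
    have := congrArg (fun w => w * (δ : ℂ)) hbb
    simpa [div_mul_cancel₀ _ hδ'] using this
  exact mul_left_cancel₀ hδ' (hi hb hb' h1)

/-- The image of the window under the transport map is the window of `h '' V`. -/
theorem transportMap_image_window (hδ : δ ≠ 0) :
    transportMap h δ '' {b : ℂ | (δ : ℂ) * b ∈ V} = {b : ℂ | (δ : ℂ) * b ∈ h '' V} := by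
  have hδ' : (δ : ℂ) ≠ 0 := Complex.ofReal_ne_zero.2 hδ
  ext b'
  simp only [mem_image, mem_setOf_eq, transportMap]
  constructor
  · rintro ⟨b, hb, rfl⟩
    exact ⟨(δ : ℂ) * b, hb, by rw [mul_div_cancel₀ _ hδ']⟩
  · rintro ⟨w, hw, hw'⟩
    refine ⟨w / (δ : ℂ), ?_, ?_⟩
    · rwa [mul_div_cancel₀ _ hδ']
    · rw [mul_div_cancel₀ _ hδ', hw', mul_div_cancel_left₀ _ hδ']

end Elementary

/-! ### Step 1: the transported event is a preimage of the image rectangle's crossing event -/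

/-- **Event identity.** At mesh `δ`, with the window `V/δ` relatively compact, the transported
crossing event is the preimage of `crossEvent (h • R) δ` under transport of both colours by
`PointConfig.imageRestrict (transportMap h δ) (V/δ)` (definitional, once arcs and carrier of `h • R` are
rewritten as `h`-images). -/
theorem hCrossEvent_eq_preimage (R : ConformalRectangle) {h : ℂ → ℂ}
    (hd : DifferentiableOn ℂ h (closure R.carrier)) (hi : InjOn h (closure R.carrier))
    {V K : Set ℂ} {δ : ℝ} (hK : IsCompact K) (hVK : {b : ℂ | (δ : ℂ) * b ∈ V} ⊆ K) :
    hCrossEvent R h V δ =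
      (fun c : PointConfig ℂ × PointConfig ℂ =>
        (PointConfig.imageRestrict (transportMap h δ) {b | (δ : ℂ) * b ∈ V} c.1,
          PointConfig.imageRestrict (transportMap h δ) {b | (δ : ℂ) * b ∈ V} c.2)) ⁻¹'
        crossEvent (R.imageUnivalent h hd hi) δ := by
  ext c
  simp only [hCrossEvent, crossEvent, transportSet, mem_setOf_eq, mem_preimage,
    MarkedDomain.arc_imageUnivalent, MarkedDomain.carrier_imageUnivalent,
    PointConfig.coe_imageRestrict hK hVK]

/-- Crossing events of image rectangles only depend on `h` restricted to `closure Ω`. -/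
theorem crossEvent_imageUnivalent_congr (R : ConformalRectangle) {h h' : ℂ → ℂ}
    (hd : DifferentiableOn ℂ h (closure R.carrier)) (hi : InjOn h (closure R.carrier))
    (hd' : DifferentiableOn ℂ h' (closure R.carrier)) (hi' : InjOn h' (closure R.carrier))
    (heq : EqOn h h' (closure R.carrier)) (δ : ℝ) :
    crossEvent (R.imageUnivalent h hd hi) δ = crossEvent (R.imageUnivalent h' hd' hi') δ := by
  have harc : ∀ i, h '' R.arc i = h' '' R.arc i := fun i =>
    (heq.mono ((MarkedDomain.arc_subset_frontier R i).trans frontier_subset_closure)).image_eq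
  have hcar : h '' R.carrier = h' '' R.carrier := (heq.mono subset_closure).image_eq
  ext c
  simp only [crossEvent, mem_setOf_eq, MarkedDomain.arc_imageUnivalent,
    MarkedDomain.carrier_imageUnivalent, harc, hcar]

/-- The transported crossing event only depends on `h` restricted to `V ∪ closure Ω`. -/
theorem hCrossEvent_congr (R : ConformalRectangle) {h h' : ℂ → ℂ} {V : Set ℂ}
    (heq : EqOn h h' (closure R.carrier)) (heqV : EqOn h h' V) (δ : ℝ) :
    hCrossEvent R h V δ = hCrossEvent R h' V δ := by
  have harc : ∀ i, h '' R.arc i = h' '' R.arc i := fun i =>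
    (heq.mono ((MarkedDomain.arc_subset_frontier R i).trans frontier_subset_closure)).image_eq
  have hcar : h '' R.carrier = h' '' R.carrier := (heq.mono subset_closure).image_eq
  have hts : ∀ c : PointConfig ℂ, transportSet h V δ c = transportSet h' V δ c := by
    intro c
    refine Set.image_congr fun b hb => ?_
    simp only [transportMap, heqV hb.2]
  ext c
  simp only [hCrossEvent, mem_setOf_eq, harc, hcar, hts]

/-! ### Step 2: the law of the transported nuclei (Mapping + Restriction + Rényi) -/

/-- **Law identity.** For `δ > 0`, transporting the inhomogeneous nuclei of the window `V/δ` by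
`b ↦ h(δ b)/δ` produces, in law, the homogeneous Poisson nuclei restricted to the window
`h(V)/δ`: both are Poisson with intensity `Leb|_{h(V)/δ}` (restricted Mapping Theorem + the
Jacobian identity `‖h′‖² = ρ` on `V`; Restriction Theorem; Rényi uniqueness). -/
theorem map_transport_poissonLaw
    {h : ℂ → ℂ} {U V : Set ℂ} (hd : DifferentiableOn ℂ h U) (hi : InjOn h U)
    (hh : Measurable h) (hV : IsOpen V) (hVb : Bornology.IsBounded V) (hVU : closure V ⊆ U)
    {ρ : ℂ → ℝ} (hρ : AdmissibleDensity ρ) (hρV : ∀ z ∈ V, ρ z = ‖deriv h z‖ ^ 2) {δ : ℝ}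
    (hδ : 0 < δ) :
    (poissonLaw (intensity ρ 1 δ)).map (PointConfig.imageRestrict (transportMap h δ) {b | (δ : ℂ) * b ∈ V}) =
      (poissonLaw volume).map (PointConfig.restrict {b : ℂ | (δ : ℂ) * b ∈ h '' V}) := by
  obtain ⟨K, hK, hVK⟩ := exists_isCompact_window hVb hδ
  have hVU' : V ⊆ U := subset_closure.trans hVU
  have hP := isPoissonPointProcess_poissonLaw_intensity ρ hρ.continuous 1 δ
  have hg : Measurable (transportMap h δ) := measurable_transportMap hh δ
  have hinj : InjOn (transportMap h δ) {b | (δ : ℂ) * b ∈ V} :=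
    injOn_transportMap (hi.mono hVU') hδ.ne'
  have h1 := hP.map_imageRestrict hg hK hVK (isOpen_window hV δ).measurableSet hinj
  have h2 : ((intensity ρ 1 δ).restrict {b | (δ : ℂ) * b ∈ V}).map (transportMap h δ) =
      volume.restrict {b : ℂ | (δ : ℂ) * b ∈ h '' V} := by
    rw [← transportMap_image_window hδ.ne']
    exact map_transport_intensity_eq h V ρ δ hV (hd.mono hVU') (hi.mono hVU') hh hδ hρV
  rw [h2] at h1
  have hopen : IsOpen (h '' V) :=
    isOpen_image_of_injOn_closure hV (hd.continuousOn.mono hVU) (hi.mono hVU)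
  have hmeas : MeasurableSet {b : ℂ | (δ : ℂ) * b ∈ h '' V} := (isOpen_window hopen δ).measurableSet
  have h3 := IsPoissonPointProcess.restrict_holds (ν := volume) (P := poissonLaw volume)
    isPoissonPointProcess_poissonLaw_volume hmeas
  exact IsPoissonPointProcess.unique_holds h1 h3

/-! ### Step 3: assembly -/

/-- **S3a for measurable `h`** (the general case follows by a measurable modification of `h`
off `U`): the key identity `P_ρ(hCrossEvent R h V δ) = P_1{the nuclei in h(V)/δ cross h • R}`
for every `δ > 0`, then the locality brick `homCrossProb_restrict_tendsto`. -/
theorem transportCoupling_core (R : ConformalRectangle) {h : ℂ → ℂ} {U : Set ℂ}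
    (hRU : closure R.carrier ⊆ U) (hd : DifferentiableOn ℂ h U) (hi : InjOn h U)
    (hh : Measurable h) {V : Set ℂ} (hV : IsOpen V) (hVb : Bornology.IsBounded V)
    (hΩV : closure R.carrier ⊆ V) (hVU : closure V ⊆ U) {ρ : ℂ → ℝ} (hρ : AdmissibleDensity ρ)
    (hρV : ∀ z ∈ V, ρ z = ‖deriv h z‖ ^ 2) :
    Tendsto (fun δ => homCrossProb (R.imageUnivalent h (hd.mono hRU) (hi.mono hRU)) δ
      - (lawBW (intensity ρ 1 δ)).real (hCrossEvent R h V δ)) (𝓝[>] 0) (𝓝 0) := by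
  set S : ConformalRectangle := R.imageUnivalent h (hd.mono hRU) (hi.mono hRU) with hS
  have hVU' : V ⊆ U := subset_closure.trans hVU
  have hopen : IsOpen (h '' V) :=
    isOpen_image_of_injOn_closure hV (hd.continuousOn.mono hVU) (hi.mono hVU)
  have hSW : closure S.carrier ⊆ h '' V := by
    rw [hS, MarkedDomain.closure_carrier_imageUnivalent]
    exact image_mono hΩV
  have hL := homCrossProb_restrict_tendsto S (h '' V) hopen hSW
  -- the key identity at every mesh `δ > 0`
  have key : ∀ δ : ℝ, 0 < δ → (lawBW (intensity ρ 1 δ)).real (hCrossEvent R h V δ) =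
      (lawBW (volume : Measure ℂ)).real
        {c | (PointConfig.restrict {b : ℂ | (δ : ℂ) * b ∈ h '' V} c.1,
          PointConfig.restrict {b : ℂ | (δ : ℂ) * b ∈ h '' V} c.2) ∈ crossEvent S δ} := by
    intro δ hδ
    obtain ⟨K, hK, hVK⟩ := exists_isCompact_window hVb hδ
    set T : PointConfig ℂ → PointConfig ℂ := PointConfig.imageRestrict (transportMap h δ) {b | (δ : ℂ) * b ∈ V}
      with hT
    set Rs : PointConfig ℂ → PointConfig ℂ := PointConfig.restrict {b : ℂ | (δ : ℂ) * b ∈ h '' V}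
      with hRs
    have hTm : Measurable T := PointConfig.measurable_imageRestrict hK hVK (isOpen_window hV δ).measurableSet
      (measurable_transportMap hh δ) (injOn_transportMap (hi.mono hVU') hδ.ne')
    have hRsm : Measurable Rs := PointConfig.measurable_restrict (isOpen_window hopen δ).measurableSet
    have hlaw : (poissonLaw (intensity ρ 1 δ)).map T = (poissonLaw volume).map Rs :=
      map_transport_poissonLaw hd hi hh hV hVb hVU hρ hρV hδ
    have hE : MeasurableSet (crossEvent S δ) := stub_measurableCrossEvent S δ hδ
    have hprod : (lawBW (intensity ρ 1 δ)).map (Prod.map T T) =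
        (lawBW (volume : Measure ℂ)).map (Prod.map Rs Rs) := by
      haveI := isProbabilityMeasure_poissonLaw_intensity ρ hρ.continuous 1 δ
      haveI := isPoissonPointProcess_poissonLaw_volume.isProbabilityMeasure
      unfold lawBW
      rw [← Measure.map_prod_map _ _ hTm hTm, ← Measure.map_prod_map _ _ hRsm hRsm, hlaw]
    rw [hCrossEvent_eq_preimage R (hd.mono hRU) (hi.mono hRU) hK hVK]
    have e1 : (lawBW (intensity ρ 1 δ)).real ((fun c : PointConfig ℂ × PointConfig ℂ =>
        (T c.1, T c.2)) ⁻¹' crossEvent S δ) =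
        ((lawBW (intensity ρ 1 δ)).map (Prod.map T T)).real (crossEvent S δ) := by
      rw [measureReal_def, measureReal_def, Measure.map_apply (hTm.prodMap hTm) hE]
      rfl
    have e2 : (lawBW (volume : Measure ℂ)).real {c | (Rs c.1, Rs c.2) ∈ crossEvent S δ} =
        ((lawBW (volume : Measure ℂ)).map (Prod.map Rs Rs)).real (crossEvent S δ) := by
      rw [measureReal_def, measureReal_def, Measure.map_apply (hRsm.prodMap hRsm) hE]
      rfl
    rw [e1, hprod, ← e2]
  have hcongr : (fun δ => homCrossProb S δ - (lawBW (intensity ρ 1 δ)).real (hCrossEvent R h V δ))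
      =ᶠ[𝓝[>] 0] fun δ => -((lawBW (volume : Measure ℂ)).real
        {c | (PointConfig.restrict {b : ℂ | (δ : ℂ) * b ∈ h '' V} c.1,
          PointConfig.restrict {b : ℂ | (δ : ℂ) * b ∈ h '' V} c.2) ∈ crossEvent S δ}
        - homCrossProb S δ) := by
    filter_upwards [self_mem_nhdsWithin] with δ hδ
    rw [key δ hδ]
    ring
  refine Tendsto.congr' hcongr.symm ?_
  simpa using hL.neg

/-- A measurable modification of `h` off the open set `U`: `U.indicator h` (zero off `U`) is
measurable when `h` is continuous on `U`, and agrees with `h` on `U`. -/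
theorem measurable_indicator_of_continuousOn {h : ℂ → ℂ} {U : Set ℂ} (hU : IsOpen U)
    (hc : ContinuousOn h U) : Measurable (U.indicator h) := by
  refine measurable_of_restrict_of_restrict_compl hU.measurableSet ?_ ?_
  · have h1 : U.restrict (U.indicator h) = U.restrict h := by
      funext x
      simp [Set.restrict_apply]
    rw [h1]
    exact (continuousOn_iff_continuous_restrict.1 hc).measurable
  · have h2 : Uᶜ.restrict (U.indicator h) = fun _ => 0 := by
      funext x
      simp [Set.restrict_apply, indicator_of_notMem (show (x : ℂ) ∉ U from x.2)]
    rw [h2]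
    exact measurable_const

/-- **S3a, the transport coupling** (registered stub `stub_transportCoupling` of the crux's
skeleton): `homCrossProb (h • R) δ − P_ρ(hCrossEvent R h V δ) → 0` as `δ → 0⁺`. -/
theorem stub_transportCoupling : Sig.stub_transportCoupling := by
  intro R h U hU hRU hd hi V hV hVb hΩV hVU ρ hρ hρV
  -- measurable modification of `h` off `U`
  set h' : ℂ → ℂ := U.indicator h with hh'
  have heqU : EqOn h h' U := fun x hx => (Set.indicator_of_mem hx h).symm
  have hh'm : Measurable h' := measurable_indicator_of_continuousOn hU hd.continuousOn
  have hd' : DifferentiableOn ℂ h' U := hd.congr fun x hx => (heqU hx).symm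
  have hi' : InjOn h' U := hi.congr heqU
  have hVU' : V ⊆ U := subset_closure.trans hVU
  have hρV' : ∀ z ∈ V, ρ z = ‖deriv h' z‖ ^ 2 := by
    intro z hz
    rw [hρV z hz]
    congr 2
    refine Filter.EventuallyEq.deriv_eq ?_
    filter_upwards [hU.mem_nhds (hVU' hz)] with w hw
    exact heqU hw
  have hcore := transportCoupling_core R hRU hd' hi' hh'm hV hVb hΩV hVU hρ hρV'
  refine hcore.congr' (Eventually.of_forall fun δ => ?_)
  dsimp only
  unfold homCrossProb
  rw [crossEvent_imageUnivalent_congr R (hd'.mono hRU) (hi'.mono hRU) (hd.mono hRU) (hi.mono hRU)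
    (heqU.symm.mono hRU) δ, hCrossEvent_congr R (heqU.symm.mono hRU) (heqU.symm.mono hVU') δ]

end Summit.CriticalPhenomena.CardyFormulaZ2.Cruxes.VoronoiHubFromSmirnov.MoebiusExactDelaunayDilationWard

end
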